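import Literature.AnabelianGeometry.EtaleTheta.Discharge.Sec1ZNClauseStructure
import Literature.AnabelianGeometry.EtaleTheta.Discharge.Sec1ZNSplittingOfCuspSection
import Literature.AnabelianGeometry.EtaleTheta.SettingModelKrullOpenSubgroups
import Literature.FieldTheory.KummerAbelianExponentContainment
import Mathlib.FieldTheory.Galois.Profinite
import Mathlib.Topology.Algebra.OpenSubgroup
import HarnessLib

/-!
# [EtTh] §1 p. 14: «[by the definition of `J_N`]» — `G_{J_N}` is carried by every isomorphism of
# tempered fundamental groups carrying `Δ^tp_X` and the `G_{K_N}`-membership (haugJN ⟸ haugN, modulo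
# strong completeness of `G_{ℚ_p}`)

Mochizuki, *The étale theta function and its Frobenioid-theoretic manifestations*, Publ. RIMS **45**
(2009), §1, PRIMS PDF p. 14: "`J_N := K_N(a^{1/N})_{a ∈ K_N}` … [since `K_N^×` is topologically finitely
generated] `J_N` is a finite Galois extension of `K_N` … it follows [by the definition of `J_N`] that all
splittings … determine the same splitting over `G_{J_N}`" [cite: MochizukiEtTh2009, §1 p.14].

abc-iut cell, layer L2, seat abc-iut-L2-t1 (§1 ROOT owner, gen 6). PROOF-ONLY companion (no
definition, no `Prop`-valued definition, no new named fact) of this seat's `Sec1ZNTransportOfSplitting`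
(p454350: the binder **haugJN** `Dβ.aug (γ g) ∈ G_{J_N,β} ↔ Dα.aug g ∈ G_{J_N,α}` of
`map_GtpZN_eq_of_splitting`, and `aug_map_eq_iff`), `Sec1ZNClauseStructure` (p457354:
`commutator_mem_GJN`, `pow_mem_GJN` — `Gal(J_N/K_N)` abelian of exponent `N`), of abc-iut-w5-d062's
KUMMER CONTAINMENT `Literature.FieldTheory.KummerContainment.fixingSubgroup_adjoin_roots_le_ker`
(every homomorphism `G_{K_N} → A` to a finite abelian group killed by `N` with OPEN kernel dies on
`G_{J_N}`), and of `SettingModelKrullOpenSubgroups` (`ThetaSetting.isOpen_GJN`: `J_N/ℚ_p` is finite),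
all consumed BY NAME.

* **`Thm16Sub.aug_map_mem_GJN_of_mem_GJN`** — for `γ : Π^tp_{Xα} ⥲ Π^tp_{Xβ}` with (hΔ) and the
  `G_{K_N}`-membership transport (leaf L04, `haugN`), GRANTED strong completeness of `G_{ℚ_p}`
  («every finite-index subgroup is open» — the Nikolov–Segal instance, tree
  `forall_finiteIndex_isOpen_absoluteGaloisGroup_of_tfg` under topological finite generation; an
  explicit hypothesis here): `aug_α g ∈ G_{J_N,α} ⇒ aug_β(γ g) ∈ G_{J_N,β}`.  Proof: the Galois
  correspondence `ψ : G_{K_N,α} → G_{K_N,β}`, `σ ↦ aug_β(γ g_σ)` (`aug_α g_σ = σ`; a homomorphism by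
  `aug_map_eq_iff`), composed with `G_{K_N,β} ↠ G_{K_N,β}/G_{J_N,β}` (finite — `G_{J_N,β}` is open in
  the compact `G_{ℚ_p}` — abelian and killed by `N`) has a kernel of finite index in `G_{ℚ_p}`, hence
  OPEN; by Kummer containment it contains `G_{J_N,α}`;
* **`Thm16Sub.haugJN_of_haugN`** — both directions (`γ⁻¹`); so the binder haugJN of p454350 /
  p456637 / p458312 is DISCHARGED modulo strong completeness of `G_{ℚ_p}`:
  `map_GtpZN_eq_of_splitting_of_stronglyComplete` (the Thm. 1.6 (iii) knits of p456637 take haugJN per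
  level — plug `haugJN_of_haugN`).

HONEST FRAMING: [EtTh] is refereed; nothing asserted; strong completeness of `G_{ℚ_p}` is an explicit
hypothesis (a theorem of the tree under topological finite generation of `G_{ℚ_p}`); typed ≠ proved;
nothing here bears on [IUTchIII] Cor. 3.12.
-/

noncomputable section

namespace Literature.AnabelianGeometry.EtaleTheta

open Literature.AnabelianGeometry.SemiGraphs

namespace Thm16Sub

variable {p : ℕ} [Fact p.Prime]

section TwoSettings

variable (Dα Dβ : ThetaSetting p) (γ : Dα.PiTemp ≃ₜ* Dβ.PiTemp)
  (hΔ : Dα.DeltaTemp.map γ.toMulEquiv.toMonoidHom = Dβ.DeltaTemp)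

/-- The `G_{K_N}`-membership transport for `γ⁻¹`. [cite: MochizukiEtTh2009, §1 p.13] -/
theorem haugN_symm (N : ℕ+)
    (haugN : ∀ g : Dα.PiTemp, Dβ.aug (γ.toMulEquiv g) ∈ Dβ.GKN N ↔ Dα.aug g ∈ Dα.GKN N)
    (g : Dβ.PiTemp) : Dα.aug (γ.symm.toMulEquiv g) ∈ Dα.GKN N ↔ Dβ.aug g ∈ Dβ.GKN N := by
  rw [← haugN]
  change Dβ.aug (γ (γ.symm g)) ∈ Dβ.GKN N ↔ _
  rw [γ.apply_symm_apply]

include hΔ in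
/-- **`aug_α g ∈ G_{J_N,α} ⇒ aug_β(γ g) ∈ G_{J_N,β}`** («[by the definition of `J_N`]», p. 14), granted
(hΔ), the `G_{K_N}`-membership transport and STRONG COMPLETENESS of `G_{ℚ_p}`: Kummer containment applied
to `G_{K_N,α} → G_{K_N,β}/G_{J_N,β}` (finite abelian of exponent `N`, kernel of finite index hence open).
[cite: MochizukiEtTh2009, §1 p.14] -/
theorem aug_map_mem_GJN_of_mem_GJN (N : ℕ+)
    (haugN : ∀ g : Dα.PiTemp, Dβ.aug (γ.toMulEquiv g) ∈ Dβ.GKN N ↔ Dα.aug g ∈ Dα.GKN N)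
    (hsc : ∀ H : Subgroup (GQp p), H.FiniteIndex → IsOpen (H : Set (GQp p)))
    {g : Dα.PiTemp} (hg : Dα.aug g ∈ Dα.GJN N) : Dβ.aug (γ.toMulEquiv g) ∈ Dβ.GJN N := by
  classical
  -- lifts of the elements of `G_{K_N,α}` to `Π^tp_{Y_N,α}`
  choose lift hlift using fun σ : ↥(Dα.GKN N) => exists_mem_GtpYN_aug_eq Dα N σ.2
  have hψmem : ∀ σ : ↥(Dα.GKN N), Dβ.aug (γ.toMulEquiv (lift σ)) ∈ Dβ.GKN N := fun σ => by
    rw [haugN, (hlift σ).2]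
    exact σ.2
  have hψval : ∀ (σ : ↥(Dα.GKN N)) (x : Dα.PiTemp), Dα.aug x = σ →
      Dβ.aug (γ.toMulEquiv x) = Dβ.aug (γ.toMulEquiv (lift σ)) := fun σ x hx => by
    rw [aug_map_eq_iff Dα Dβ γ hΔ, hx, (hlift σ).2]
  -- the Galois correspondence `ψ : G_{K_N,α} →* G_{K_N,β}`
  let ψ : ↥(Dα.GKN N) →* ↥(Dβ.GKN N) :=
    { toFun := fun σ => ⟨Dβ.aug (γ.toMulEquiv (lift σ)), hψmem σ⟩
      map_one' := by
        apply Subtype.ext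
        change Dβ.aug (γ.toMulEquiv (lift 1)) = 1
        rw [← hψval 1 1 (by rw [map_one]; rfl), map_one, map_one]
      map_mul' := fun σ τ => by
        apply Subtype.ext
        change Dβ.aug (γ.toMulEquiv (lift (σ * τ))) =
          Dβ.aug (γ.toMulEquiv (lift σ)) * Dβ.aug (γ.toMulEquiv (lift τ))
        rw [← map_mul, ← map_mul,
          ← hψval (σ * τ) (lift σ * lift τ) (by rw [map_mul, (hlift σ).2, (hlift τ).2]; rfl)] }
  have hψapply : ∀ σ : ↥(Dα.GKN N), ((ψ σ : ↥(Dβ.GKN N)) : GQp p) = Dβ.aug (γ.toMulEquiv (lift σ)) :=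
    fun σ => rfl
  -- `G_{J_N,β}` inside `G_{K_N,β}`: normal, of finite index (open in the compact `G_{ℚ_p}`)
  let Jβ : Subgroup ↥(Dβ.GKN N) := (Dβ.GJN N).subgroupOf (Dβ.GKN N)
  haveI hJn : Jβ.Normal := Dβ.GJN_normal_GKN N
  haveI : Finite (GQp p ⧸ Dβ.GJN N) := Subgroup.quotient_finite_of_isOpen _ (Dβ.isOpen_GJN N)
  haveI hJfi : (Dβ.GJN N).FiniteIndex := Subgroup.finiteIndex_of_finite_quotient
  haveI : Finite (GQp p ⧸ Dα.GKN N) := Subgroup.quotient_finite_of_isOpen _ (Dα.isOpen_GKN N)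
  haveI hKfi : (Dα.GKN N).FiniteIndex := Subgroup.finiteIndex_of_finite_quotient
  haveI hJβfi : Jβ.FiniteIndex := inferInstance
  -- the quotient `A := G_{K_N,β}/G_{J_N,β}` is abelian and killed by `N`
  have hcomm : ∀ a b : ↥(Dβ.GKN N) ⧸ Jβ, a * b = b * a := by
    intro a b
    induction a using QuotientGroup.induction_on with
    | H σ =>
      induction b using QuotientGroup.induction_on with
      | H τ =>
        rw [← QuotientGroup.mk_mul, ← QuotientGroup.mk_mul, QuotientGroup.eq, Subgroup.mem_subgroupOf]
        have h := ThetaSetting.commutator_mem_GJN Dβ N (Subgroup.inv_mem _ τ.2) (Subgroup.inv_mem _ σ.2)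
        have e : (((σ * τ)⁻¹ * (τ * σ) : ↥(Dβ.GKN N)) : GQp p) =
            (τ : GQp p)⁻¹ * (σ : GQp p)⁻¹ * ((τ : GQp p)⁻¹)⁻¹ * ((σ : GQp p)⁻¹)⁻¹ := by
          change ((σ : GQp p) * τ)⁻¹ * ((τ : GQp p) * σ) = _
          group
        rw [e]
        exact h
  letI : CommGroup (↥(Dβ.GKN N) ⧸ Jβ) := { (inferInstance : Group (↥(Dβ.GKN N) ⧸ Jβ)) with mul_comm := hcomm }
  have hA : ∀ a : ↥(Dβ.GKN N) ⧸ Jβ, a ^ (N : ℕ) = 1 := by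
    intro a
    induction a using QuotientGroup.induction_on with
    | H σ =>
      rw [← QuotientGroup.mk_pow, QuotientGroup.eq_one_iff, Subgroup.mem_subgroupOf]
      exact ThetaSetting.pow_mem_GJN Dβ N σ.2
  -- `φ : G_{K_N,α} → A`, kernel of finite index, hence open by strong completeness
  let φ : ↥(Dα.GKN N) →* ↥(Dβ.GKN N) ⧸ Jβ := (QuotientGroup.mk' Jβ).comp ψ
  have hker : φ.ker = Jβ.comap ψ := by
    rw [← MonoidHom.comap_ker, QuotientGroup.ker_mk']
  haveI hφfi : φ.ker.FiniteIndex := ⟨by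
    rw [hker, Subgroup.index_comap]
    exact Subgroup.FiniteIndex.index_ne_zero⟩
  have hopen : IsOpen ((φ.ker.map (Dα.GKN N).subtype : Subgroup (GQp p)) : Set (GQp p)) := by
    refine hsc _ ⟨?_⟩
    rw [Subgroup.index_map_subtype]
    exact mul_ne_zero hφfi.index_ne_zero hKfi.index_ne_zero
  -- Kummer containment on the `α` side
  haveI : NeZero (N : ℕ) := ⟨N.ne_zero⟩
  have hμ : ∀ ζ : PadicAlgCl p, ζ ^ (N : ℕ) = 1 → ζ ∈ fieldKN Dα.K Dα.qX N :=
    fun ζ hζ => mem_fieldKN_of_pow_eq_one Dα.K Dα.qX hζ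
  have hcont := Literature.FieldTheory.KummerContainment.fixingSubgroup_adjoin_roots_le_ker
    (k := ℚ_[p]) (K := PadicAlgCl p) (fieldKN Dα.K Dα.qX N) (N : ℕ) hμ hA φ hopen
  have hgJ : Dα.aug g ∈ (IntermediateField.adjoin ℚ_[p]
      ((fieldKN Dα.K Dα.qX N : Set (PadicAlgCl p)) ∪
        {x : PadicAlgCl p | x ^ (N : ℕ) ∈ fieldKN Dα.K Dα.qX N})).fixingSubgroup := hg
  obtain ⟨τ, hτ, hτg⟩ := hcont hgJ
  -- `φ τ = 1`, i.e. `aug_β(γ (lift τ)) ∈ G_{J_N,β}`; and `aug_β(γ g) = aug_β(γ (lift τ))`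
  have h1 : (QuotientGroup.mk' Jβ) (ψ τ) = 1 := hτ
  have hτ1 : ψ τ ∈ Jβ := (QuotientGroup.eq_one_iff _).mp h1
  have hval : Dβ.aug (γ.toMulEquiv g) = Dβ.aug (γ.toMulEquiv (lift τ)) := hψval τ g hτg.symm
  rw [hval, ← hψapply]
  exact (Subgroup.mem_subgroupOf).mp hτ1

include hΔ in
/-- **haugJN ⟸ haugN** («[by the definition of `J_N`]», p. 14): granted (hΔ), the `G_{K_N}`-membership
transport and strong completeness of `G_{ℚ_p}`, `aug_β(γ g) ∈ G_{J_N,β} ↔ aug_α g ∈ G_{J_N,α}` — the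
binder haugJN of `map_GtpZN_eq_of_splitting` (p454350) DISCHARGED modulo strong completeness.
[cite: MochizukiEtTh2009, §1 p.14] -/
theorem haugJN_of_haugN (N : ℕ+)
    (haugN : ∀ g : Dα.PiTemp, Dβ.aug (γ.toMulEquiv g) ∈ Dβ.GKN N ↔ Dα.aug g ∈ Dα.GKN N)
    (hsc : ∀ H : Subgroup (GQp p), H.FiniteIndex → IsOpen (H : Set (GQp p)))
    (g : Dα.PiTemp) : Dβ.aug (γ.toMulEquiv g) ∈ Dβ.GJN N ↔ Dα.aug g ∈ Dα.GJN N := by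
  refine ⟨fun h => ?_, aug_map_mem_GJN_of_mem_GJN Dα Dβ γ hΔ N haugN hsc⟩
  have h' : Dα.aug (γ.symm.toMulEquiv (γ.toMulEquiv g)) ∈ Dα.GJN N :=
    aug_map_mem_GJN_of_mem_GJN Dβ Dα γ.symm (hΔ_symm Dα Dβ γ hΔ) N (haugN_symm Dα Dβ γ N haugN) hsc h
  have e : γ.symm.toMulEquiv (γ.toMulEquiv g) = g := γ.symm_apply_apply g
  rwa [e] at h'

include hΔ in
/-- **`γ(Π^tp_{Z_N,α}) = Π^tp_{Z_N,β}` with haugJN discharged** (p. 14): as `map_GtpZN_eq_of_splitting`,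
the `G_{J_N}`-membership transport replaced by strong completeness of `G_{ℚ_p}`.
[cite: MochizukiEtTh2009, §1 p.14] -/
theorem map_GtpZN_eq_of_splitting_of_stronglyComplete (N : ℕ+) (c : ThetaSetting.ThetaCompanion γ)
    (hY : Dα.GtpY.map γ.toMulEquiv.toMonoidHom = Dβ.GtpY)
    (hYN : (Dα.GtpYN N).map γ.toMulEquiv.toMonoidHom = Dβ.GtpYN N)
    (haugN : ∀ g : Dα.PiTemp, Dβ.aug (γ.toMulEquiv g) ∈ Dβ.GKN N ↔ Dα.aug g ∈ Dα.GKN N)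
    (hsc : ∀ H : Subgroup (GQp p), H.FiniteIndex → IsOpen (H : Set (GQp p)))
    (hzα : Dα.GtpZNFromSplitting N) (hsα : ∃ s, Dα.IsThetaSplittingAt N s)
    (hzβ : Dβ.GtpZNFromSplitting N) :
    (Dα.GtpZN N).map γ.toMulEquiv.toMonoidHom = Dβ.GtpZN N :=
  map_GtpZN_eq_of_splitting Dα Dβ γ hΔ N c hY hYN haugN (haugJN_of_haugN Dα Dβ γ hΔ N haugN hsc)
    hzα hsα hzβ

end TwoSettings

end Thm16Sub

end Literature.AnabelianGeometry.EtaleTheta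

end
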